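/-
COR-CM (cell pub-hodgecm2, stage 2 of the Hodge ladder) — count-neutral KERNEL COMBINATORICS «the sheared dihedral family», part XVI: at least twelve
residual blocks in the `X_n` label model (seat prover-pub-hodgecm2-b23-g52-0, binder prover b23, gen 52; claim «SYLOW TRANSFER XII + THE SHEARED DIHEDRAL
FAMILY», HOME/INBOX.md l.23708).  Theorems only, on part XV (`Census/ShearedDihedralBlocks.lean`) and gen 44ʼs `Census/QuarticInversionResidualBlocks.lean`
(`kLab`, `aLab`, `kpat`, `pot₄_kLab`, `cl_kLab`, `hv_kLab`, `pot₄_aLab`, `cl_aLab`, `hv_aLab`) BY NAME; `decide` only on closed Boolean statements over at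
most six Boolean literals, no certificate, no named fact, no `sorry`.  `Interfaces.lean` (C1), every E term, B01, `Transposition/*`, `PortJoin/*`,
`D2Bridge/*` untouched.
HONEST FRAMING: `HC_CM` is NOT proved, here or anywhere in the tree; nothing here is a period, a count of record or a headline.
-/
import Summits.HodgeConjecture.CorCM.Census.ShearedDihedralBlocks
import Summits.HodgeConjecture.CorCM.Census.QuarticInversionResidualBlocks

/-!
# The sheared dihedral family, XVI: twelve residual blocks (potential `≤ 1`) of the `X_n` label model

gen 44ʼs part XXII for the `X_n` motions: the invariant vector `invS = (pot₄, sigS)` of part XV takes twelve distinct values on gen 44ʼs four constant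
labels `kLab (kpat p k)` and eight atom labels `aLab ![false, x, y, z]` (`invS_kLab`, `invS_aLab`, `sigS_aLab_inj`, `sigS_kpat_inj`), so the model has
**at least twelve residual blocks** (`twelve_le_card_residualS`; `|B|` odd `≥ 3`).  Numerically (`tools46/residual.py`, `xprod.py`) this is an equality
for `B = ℤ/3, ℤ/5` — as for gen 44ʼs `D(ℤ/4m)` and gen 45ʼs `D₄ × B`.  With one reducing face per non-residual block (part X) the X_n column therefore
needs TEN closing faces for the count `β − 2` (`HOME/pub-hodgecm2-b23/SHEARED-DIHEDRAL.md` §3b–§3c).  All [folklore].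

## References
* [Pohlmann1968] H. Pohlmann, Algebraic cycles on abelian varieties of complex multiplication type, Ann. of Math. 88 (1968), Thm 1.
-/

namespace Summit.HodgeConjecture.CorCM.Census.ShearedDihedral

open Finset
open Summit.HodgeConjecture.CorCM.Census.OddSliceFacesModel
open Summit.HodgeConjecture.CorCM.Census.QuarticInversion

noncomputable section

variable (A : Type) [AddCommGroup A] [Fintype A] [DecidableEq A]

/-! ## §1 Invariant vectors of constant and atom labels -/

omit [AddCommGroup A] [DecidableEq A] in
/-- **The invariant vector of a constant label.** [folklore] -/
theorem invS_kLab (h1 : 1 ≤ Fintype.card A) (b : Fin 4 → Bool) : invS A (kLab A b) = (0, sigAllS (fun _ => false) b) := by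
  unfold invS sigS; rw [pot₄_kLab, cl_kLab, hv_kLab A h1]

/-- **The invariant vector of an atom label.** [folklore] -/
theorem invS_aLab (h2 : 2 ≤ Fintype.card A) (b : Fin 4 → Bool) :
    invS A (aLab A b) = (1, sigAllS (fun n => decide (n = 0)) (fun n => if n = 0 then true else b n)) := by
  unfold invS sigS; rw [pot₄_aLab A h2, cl_aLab A h2, hv_aLab A h2]

/-! ## §2 Twelve residual blocks -/

/-- **The eight atom labels have distinct signatures.** [folklore] -/
theorem sigS_aLab_inj {x y z x' y' z' : Bool}
    (h : sigAllS (fun n => decide (n = 0)) (fun n => if n = 0 then true else (![false, x, y, z] : Fin 4 → Bool) n) =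
      sigAllS (fun n => decide (n = 0)) (fun n => if n = 0 then true else (![false, x', y', z'] : Fin 4 → Bool) n)) :
    (x, y, z) = (x', y', z') := by
  revert x y z x' y' z'; decide

/-- **The four constants `kpat p k` have distinct signatures.** [folklore] -/
theorem sigS_kpat_inj {p k p' k' : Bool} (h : sigAllS (fun _ => false) (kpat p k) = sigAllS (fun _ => false) (kpat p' k')) :
    (p, k) = (p', k') := by
  revert p k p' k'; decide

/-- **AT LEAST TWELVE RESIDUAL BLOCKS** in the `X_n` label model (`|B|` odd `≥ 3`): eight atom blocks and four constant blocks. [folklore] -/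
theorem twelve_le_card_residualS (hA : Odd (Fintype.card A)) (h2 : 2 ≤ Fintype.card A) :
    12 ≤ (univ.filter fun B : BlockS A => potBS A B ≤ 1).card := by
  have h1 : 1 ≤ Fintype.card A := by omega
  let f : (Bool × Bool × Bool) ⊕ (Bool × Bool) → {B : BlockS A // potBS A B ≤ 1} := fun i =>
    match i with
    | Sum.inl ⟨x, y, z⟩ => ⟨blkS A (aLab A ![false, x, y, z]), by rw [potBS_blkS, pot₄_aLab A h2]⟩
    | Sum.inr ⟨p, k⟩ => ⟨blkS A (kLab A (kpat p k)), by rw [potBS_blkS, pot₄_kLab]; exact Nat.zero_le 1⟩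
  have hf : Function.Injective f := by
    rintro (⟨x, y, z⟩ | ⟨p, k⟩) (⟨x', y', z'⟩ | ⟨p', k'⟩) hii' <;> have hb := invS_eq_of_blkS_eq A hA (congrArg Subtype.val hii')
    · rw [invS_aLab A h2, invS_aLab A h2, Prod.mk.injEq] at hb
      rw [sigS_aLab_inj hb.2]
    · rw [invS_aLab A h2, invS_kLab A h1, Prod.mk.injEq] at hb
      exact absurd hb.1 one_ne_zero
    · rw [invS_kLab A h1, invS_aLab A h2, Prod.mk.injEq] at hb
      exact absurd hb.1.symm one_ne_zero
    · rw [invS_kLab A h1, invS_kLab A h1, Prod.mk.injEq] at hb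
      rw [sigS_kpat_inj hb.2]
  have hcard := Fintype.card_le_of_injective f hf
  rw [Fintype.card_subtype] at hcard
  simpa using hcard

end

end Summit.HodgeConjecture.CorCM.Census.ShearedDihedral
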